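import Mathlib
import HarnessLib
import Summits.HubbardSuperconductivity.HubbardSuperconductivity.Theorems.DeformationLadderLowEnergyRigidityFibration
import Summits.HubbardSuperconductivity.HubbardSuperconductivity.Theorems.DeformationLadderLowEnergyRigiditySpectralTransfer

/-!
# Route `DeformationLadder` — crux `LowEnergyRigidity` (stmt-HubbardSuperconductivity-1892),
# crux idea `heavy-condensate-fibration`: spectral algebra of the cutoffs `f(A)`

Finite-dimensional spectral bookkeeping for the functional calculus `f(A) = Matrix.IsHermitian.cfc`
of a Hermitian matrix `A = U diag(μ) U⋆`, as consumed by the smooth cutoff pair of the fibration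
(companion `…LowEnergyRigidityCompressionGap`): `f(A)g(A) = (fg)(A)`, sums, scalars, `id(A) = A`,
constants, Hermiticity, positivity (`hcf_cfc_posSemidef`), the polynomial picture
(`hcf_cfc_eq_aeval`: `f(A) = p(A)` with `p` interpolating `f` on the spectrum — hence `f(A)`
preserves every `A`-invariant subspace, `hcf_cfc_mulVec_mem`, and acts on eigenvectors by
`f(μ)`, `hcf_cfc_mulVec_of_eigenvector`), the range statement `f(A) v ∈ ⊕_{μ≤b} ker(A - μ)` when `f`
vanishes above `b` (`hcf_cfc_mulVec_mem_iSup_eigenspace`), the Markov domination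
`a ‖g(A)v‖² ≤ Re⟨v,Av⟩` when `a g² ≤ x` (`hcf_cfc_sq_form_le`), the spectral bound
`Re⟨v,Av⟩ ≤ b‖v‖²` on `⊕_{μ≤b} ker(A - μ)` (`hcf_re_expect_le_of_mem_iSup_eigenspace`), and
`μᵢ ≤ ‖A‖` (`hcf_eigenvalues_le_norm`). All folklore linear algebra.
-/

namespace Summit.HubbardSuperconductivity.HubbardSuperconductivity.Theorems

set_option linter.dupNamespace false

open Matrix Complex
open scoped Matrix.Norms.L2Operator ComplexOrder

section SpectralCutoffs

variable {n : Type*} [Fintype n] [DecidableEq n] {A : Matrix n n ℂ} (hA : A.IsHermitian)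

/-- `f(A) g(A) = (fg)(A)`. [folklore] -/
theorem hcf_cfc_mul (f g : ℝ → ℝ) : hA.cfc f * hA.cfc g = hA.cfc (fun x => f x * g x) := by
  rw [hcf_cfc_eq_conj, hcf_cfc_eq_conj, hcf_cfc_eq_conj, ← map_mul, diagonal_mul_diagonal]
  congr 2
  funext i
  push_cast
  ring

/-- `f(A) + g(A) = (f+g)(A)`. [folklore] -/
theorem hcf_cfc_add (f g : ℝ → ℝ) : hA.cfc f + hA.cfc g = hA.cfc (fun x => f x + g x) := by
  rw [hcf_cfc_eq_conj, hcf_cfc_eq_conj, hcf_cfc_eq_conj, ← map_add, diagonal_add]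
  congr 2
  funext i
  push_cast
  ring

/-- `f(A) - g(A) = (f-g)(A)`. [folklore] -/
theorem hcf_cfc_sub (f g : ℝ → ℝ) : hA.cfc f - hA.cfc g = hA.cfc (fun x => f x - g x) := by
  rw [hcf_cfc_eq_conj, hcf_cfc_eq_conj, hcf_cfc_eq_conj, ← map_sub, diagonal_sub]
  congr 2
  funext i
  push_cast
  ring

/-- `c • f(A) = (c f)(A)` for real `c`. [folklore] -/
theorem hcf_cfc_smul (c : ℝ) (f : ℝ → ℝ) : ((c : ℝ) : ℂ) • hA.cfc f = hA.cfc (fun x => c * f x) := by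
  rw [hcf_cfc_eq_conj, hcf_cfc_eq_conj, ← map_smul, ← diagonal_smul]
  congr 2
  funext i
  simp only [Pi.smul_apply, smul_eq_mul]
  push_cast
  ring

/-- `id(A) = A`. [folklore] -/
theorem hcf_cfc_id : hA.cfc (fun x => x) = A := by
  rw [hcf_cfc_eq_conj]
  exact (hcf_spectral hA).symm

/-- The functional calculus only sees the values at the eigenvalues. [folklore] -/
theorem hcf_cfc_congr {f g : ℝ → ℝ} (h : ∀ i, f (hA.eigenvalues i) = g (hA.eigenvalues i)) :
    hA.cfc f = hA.cfc g := by
  rw [hcf_cfc_eq_conj, hcf_cfc_eq_conj]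
  congr 2
  funext i
  rw [h i]

/-- A function equal to `1` at the eigenvalues gives the identity. [folklore] -/
theorem hcf_cfc_eq_one {f : ℝ → ℝ} (h : ∀ i, f (hA.eigenvalues i) = 1) : hA.cfc f = 1 := by
  rw [hcf_cfc_eq_conj]
  have hd : (diagonal fun i => ((f (hA.eigenvalues i) : ℝ) : ℂ)) = 1 := by
    rw [← diagonal_one]
    congr 1
    funext i
    rw [h i, Complex.ofReal_one]
  rw [hd, map_one]

/-- `f(A)` is Hermitian for real `f`. [folklore] -/
theorem hcf_cfc_conjTranspose (f : ℝ → ℝ) : (hA.cfc f)ᴴ = hA.cfc f := by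
  rw [hcf_cfc_eq_conj, ← star_eq_conjTranspose, ← map_star, star_eq_conjTranspose,
    diagonal_conjTranspose]
  congr 2
  funext i
  simp only [Pi.star_apply, Complex.star_def, Complex.conj_ofReal]

/-- **Positivity**: `f(A) ⪰ 0` if `f ≥ 0` at the eigenvalues (`U diag(f∘μ) U⋆ = U D Uᴴ`). [folklore] -/
theorem hcf_cfc_posSemidef {f : ℝ → ℝ} (hf : ∀ i, 0 ≤ f (hA.eigenvalues i)) : (hA.cfc f).PosSemidef := by
  have hD : (diagonal fun i => ((f (hA.eigenvalues i) : ℝ) : ℂ)).PosSemidef := by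
    rw [posSemidef_diagonal_iff]
    exact fun i => Complex.zero_le_real.2 (hf i)
  have h := hD.mul_mul_conjTranspose_same (hA.eigenvectorUnitary : Matrix n n ℂ)
  rw [hcf_cfc_eq_conj, Unitary.conjStarAlgAut_apply, star_eq_conjTranspose]
  exact h

/-- Polynomials of `A = U diag(μ) U⋆` are `U diag(p(μ)) U⋆`. [folklore] -/
theorem hcf_aeval_eq_conj (p : Polynomial ℂ) :
    Polynomial.aeval A p = Unitary.conjStarAlgAut ℂ (Matrix n n ℂ) hA.eigenvectorUnitary
      (diagonal fun i => Polynomial.aeval ((hA.eigenvalues i : ℝ) : ℂ) p) := by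
  induction p using Polynomial.induction_on' with
  | add p q hp hq =>
    rw [map_add, hp, hq, ← map_add, diagonal_add]
    congr 2
    funext i
    simp only [map_add]
  | monomial k c =>
    have hsp := hcf_spectral hA
    have hpow : A ^ k = Unitary.conjStarAlgAut ℂ (Matrix n n ℂ) hA.eigenvectorUnitary
        (diagonal fun i => ((hA.eigenvalues i : ℝ) : ℂ) ^ k) := by
      have h := congrArg (fun M : Matrix n n ℂ => M ^ k) hsp
      rw [h, ← map_pow, diagonal_pow]
      rfl
    rw [Polynomial.aeval_monomial, Algebra.algebraMap_eq_smul_one, smul_one_mul, hpow, ← map_smul,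
      ← diagonal_smul]
    congr 2
    funext i
    simp only [Pi.smul_apply, smul_eq_mul, Polynomial.aeval_monomial, Algebra.algebraMap_self,
      RingHom.id_apply]

/-- **`f(A)` is a polynomial in `A`** interpolating `f` on the spectrum (Lagrange). [folklore] -/
theorem hcf_cfc_eq_aeval (f : ℝ → ℝ) : ∃ p : Polynomial ℂ, hA.cfc f = Polynomial.aeval A p ∧
    ∀ i, Polynomial.aeval ((hA.eigenvalues i : ℝ) : ℂ) p = ((f (hA.eigenvalues i) : ℝ) : ℂ) := by
  classical
  set s : Finset ℝ := Finset.univ.image hA.eigenvalues with hs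
  set q : Polynomial ℝ := Lagrange.interpolate s id f with hq
  have hqi : ∀ i, q.eval (hA.eigenvalues i) = f (hA.eigenvalues i) := fun i => by
    have h := Lagrange.eval_interpolate_at_node (s := s) (v := id) f (Set.injOn_id _)
      (Finset.mem_image_of_mem _ (Finset.mem_univ i))
    simpa only [id] using h
  have hpi : ∀ i, Polynomial.aeval ((hA.eigenvalues i : ℝ) : ℂ) (q.map (algebraMap ℝ ℂ)) =
      ((f (hA.eigenvalues i) : ℝ) : ℂ) := fun i => by
    rw [Polynomial.aeval_map_algebraMap, ← hqi]
    exact (Polynomial.ofReal_eval q _).symm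
  refine ⟨q.map (algebraMap ℝ ℂ), ?_, hpi⟩
  rw [hcf_aeval_eq_conj hA, hcf_cfc_eq_conj]
  congr 2
  funext i
  rw [hpi]

/-- Powers of a matrix preserve every invariant subspace. [folklore] -/
theorem hcf_pow_mulVec_mem (S : Submodule ℂ (n → ℂ)) (hS : ∀ v ∈ S, A *ᵥ v ∈ S) (k : ℕ) :
    ∀ v ∈ S, (A ^ k) *ᵥ v ∈ S := by
  induction k with
  | zero => intro v hv; simpa using hv
  | succ k ih =>
    intro v hv
    rw [pow_succ, ← mulVec_mulVec]
    exact ih _ (hS v hv)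

/-- Polynomials of a matrix preserve every invariant subspace. [folklore] -/
theorem hcf_aeval_mulVec_mem (S : Submodule ℂ (n → ℂ)) (hS : ∀ v ∈ S, A *ᵥ v ∈ S)
    (p : Polynomial ℂ) : ∀ v ∈ S, (Polynomial.aeval A p) *ᵥ v ∈ S := by
  induction p using Polynomial.induction_on' with
  | add p q hp hq =>
    intro v hv
    rw [map_add, add_mulVec]
    exact S.add_mem (hp v hv) (hq v hv)
  | monomial k c =>
    intro v hv
    rw [Polynomial.aeval_monomial, Algebra.algebraMap_eq_smul_one, smul_one_mul, smul_mulVec]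
    exact S.smul_mem c (hcf_pow_mulVec_mem S hS k v hv)

/-- **`f(A)` preserves every `A`-invariant subspace.** [folklore] -/
theorem hcf_cfc_mulVec_mem (S : Submodule ℂ (n → ℂ)) (hS : ∀ v ∈ S, A *ᵥ v ∈ S) (f : ℝ → ℝ) :
    ∀ v ∈ S, hA.cfc f *ᵥ v ∈ S := by
  obtain ⟨p, hp, -⟩ := hcf_cfc_eq_aeval hA f
  rw [hp]
  exact hcf_aeval_mulVec_mem S hS p

/-- Polynomials act on eigenvectors by their value: `p(A) v = p(μ) v` if `A v = μ v`. [folklore] -/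
theorem hcf_aeval_mulVec_of_eigenvector (p : Polynomial ℂ) {v : n → ℂ} {μ : ℂ} (hv : A *ᵥ v = μ • v) :
    (Polynomial.aeval A p) *ᵥ v = (Polynomial.aeval μ p) • v := by
  induction p using Polynomial.induction_on' with
  | add p q hp hq => rw [map_add, map_add, add_mulVec, hp, hq, add_smul]
  | monomial k c =>
    have hpow : ∀ j : ℕ, (A ^ j) *ᵥ v = (μ ^ j) • v := by
      intro j
      induction j with
      | zero => simp
      | succ j ih => rw [pow_succ, ← mulVec_mulVec, hv, mulVec_smul, ih, smul_smul, ← pow_succ']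
    rw [Polynomial.aeval_monomial, Polynomial.aeval_monomial, Algebra.algebraMap_eq_smul_one,
      smul_one_mul, smul_mulVec, hpow, smul_smul, Algebra.algebraMap_self, RingHom.id_apply]

/-- **`f(A)` acts on eigenvectors by `f(μ)`**: if `A v = μ v` with `v ≠ 0` (so `μ` is an
eigenvalue) then `f(A) v = f(μ) v`. [folklore] -/
theorem hcf_cfc_mulVec_of_eigenvector (f : ℝ → ℝ) {v : n → ℂ} {μ : ℝ} (hv : A *ᵥ v = (μ : ℂ) • v)
    (hv0 : v ≠ 0) : hA.cfc f *ᵥ v = ((f μ : ℝ) : ℂ) • v := by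
  -- `μ` is one of the eigenvalues
  have hev : Module.End.HasEigenvalue (Matrix.toLin' A) (μ : ℂ) := by
    refine Module.End.hasEigenvalue_of_hasEigenvector ⟨?_, hv0⟩
    rw [Module.End.mem_eigenspace_iff, Matrix.toLin'_apply, hv]
  have hsp : (μ : ℂ) ∈ spectrum ℂ A := by
    rw [← Matrix.spectrum_toLin']
    exact Module.End.hasEigenvalue_iff_mem_spectrum.1 hev
  have hspR : μ ∈ spectrum ℝ A := (spectrum.algebraMap_mem_iff ℂ).1 hsp
  rw [hA.spectrum_real_eq_range_eigenvalues] at hspR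
  obtain ⟨i, hi⟩ := hspR
  obtain ⟨p, hp, hpi⟩ := hcf_cfc_eq_aeval hA f
  rw [hp, hcf_aeval_mulVec_of_eigenvector p hv, ← hi, hpi i]

/-- Expansion of `U diag(d) U⋆ v` along the eigenvector columns:
`U diag(d) U⋆ v = Σ_i (d_i (U⋆v)_i) • u_i`. [folklore] -/
theorem hcf_conj_diagonal_mulVec_eq_sum (d : n → ℂ) (v : n → ℂ) :
    Unitary.conjStarAlgAut ℂ (Matrix n n ℂ) hA.eigenvectorUnitary (diagonal d) *ᵥ v =
      ∑ i, (d i * ((star (hA.eigenvectorUnitary : Matrix n n ℂ)) *ᵥ v) i) •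
        (⇑(hA.eigenvectorBasis i) : n → ℂ) := by
  rw [Unitary.conjStarAlgAut_apply, ← mulVec_mulVec, ← mulVec_mulVec]
  ext j
  change ∑ i, (hA.eigenvectorUnitary : Matrix n n ℂ) j i *
      (diagonal d *ᵥ (star (hA.eigenvectorUnitary : Matrix n n ℂ) *ᵥ v)) i = _
  simp only [mulVec_diagonal, Finset.sum_apply, Pi.smul_apply, smul_eq_mul,
    Matrix.IsHermitian.eigenvectorUnitary_apply]
  refine Finset.sum_congr rfl fun i _ => ?_
  ring

/-- **`f(A)` maps into the low spectral subspace** if `f` vanishes above `b`: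
`f(A) v ∈ ⊕_{μ ≤ b} ker(A - μ)` for every `v`. [folklore] -/
theorem hcf_cfc_mulVec_mem_iSup_eigenspace (f : ℝ → ℝ) (b : ℝ)
    (hf : ∀ i, b < hA.eigenvalues i → f (hA.eigenvalues i) = 0) (v : n → ℂ) :
    hA.cfc f *ᵥ v ∈ ⨆ (μ : ℝ) (_ : μ ≤ b), Module.End.eigenspace (Matrix.toLin' A) (μ : ℂ) := by
  rw [hcf_cfc_eq_conj, hcf_conj_diagonal_mulVec_eq_sum]
  refine Submodule.sum_mem _ fun i _ => ?_
  by_cases hi : b < hA.eigenvalues i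
  · rw [hf i hi, Complex.ofReal_zero, zero_mul, zero_smul]
    exact Submodule.zero_mem _
  · have hle : hA.eigenvalues i ≤ b := le_of_not_gt hi
    refine Submodule.smul_mem _ _ ?_
    refine Submodule.mem_iSup_of_mem (hA.eigenvalues i) (Submodule.mem_iSup_of_mem hle ?_)
    rw [Module.End.mem_eigenspace_iff, Matrix.toLin'_apply, hA.mulVec_eigenvectorBasis i]
    ext j
    simp only [Pi.smul_apply, smul_eq_mul, RCLike.real_smul_eq_coe_mul]
    rfl

/-- **Markov domination**: if `a g(μᵢ)² ≤ μᵢ` at every eigenvalue then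
`a ‖g(A) v‖² ≤ Re⟨v, A v⟩` for every `v` (`A - a g(A)² = (x - a g²)(A) ⪰ 0`). [folklore] -/
theorem hcf_cfc_sq_form_le (g : ℝ → ℝ) (a : ℝ)
    (hg : ∀ i, a * g (hA.eigenvalues i) ^ 2 ≤ hA.eigenvalues i) (v : n → ℂ) :
    a * (star (hA.cfc g *ᵥ v) ⬝ᵥ (hA.cfc g *ᵥ v)).re ≤ (star v ⬝ᵥ (A *ᵥ v)).re := by
  have h1 : star (hA.cfc g *ᵥ v) ⬝ᵥ (hA.cfc g *ᵥ v) =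
      star v ⬝ᵥ (hA.cfc (fun x => g x * g x) *ᵥ v) := by
    rw [hcf_star_mulVec_dotProduct, hcf_cfc_conjTranspose, mulVec_mulVec, hcf_cfc_mul]
  have hpsd : (A - ((a : ℝ) : ℂ) • hA.cfc (fun x => g x * g x)).PosSemidef := by
    have h := hcf_cfc_posSemidef hA (f := fun x => x - a * (g x * g x)) fun i => by nlinarith [hg i]
    rwa [← hcf_cfc_sub, ← hcf_cfc_smul, hcf_cfc_id] at h
  have h2 := hpsd.dotProduct_mulVec_nonneg v
  rw [sub_mulVec, dotProduct_sub, smul_mulVec, dotProduct_smul, sub_nonneg] at h2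
  have h3 := (Complex.le_def.1 h2).1
  rw [smul_eq_mul, Complex.re_ofReal_mul] at h3
  rw [h1]
  exact h3

include hA in
/-- **Spectral bound on the low subspace**: `Re⟨v, A v⟩ ≤ b ‖v‖²` for
`v ∈ ⊕_{μ ≤ b} ker(A - μ)` (the spectral projection `P = 𝟙_{(-∞,b]}(A)` fixes `v`, and
`b P² - P A P = (𝟙 (b - x) 𝟙)(A) ⪰ 0`). [folklore] -/
theorem hcf_re_expect_le_of_mem_iSup_eigenspace (b : ℝ) {v : n → ℂ}
    (hv : v ∈ ⨆ (μ : ℝ) (_ : μ ≤ b), Module.End.eigenspace (Matrix.toLin' A) (μ : ℂ)) :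
    (star v ⬝ᵥ (A *ᵥ v)).re ≤ b * (star v ⬝ᵥ v).re := by
  classical
  set χ : ℝ → ℝ := fun x => if x ≤ b then 1 else 0 with hχ
  set P := hA.cfc χ with hP
  -- `P v = v`
  have hPv : P *ᵥ v = v := by
    refine Submodule.iSup_induction (motive := fun x => P *ᵥ x = x) _ hv ?_ (by simp) ?_
    · intro μ x hx
      by_cases hμ : μ ≤ b
      · rw [iSup_pos hμ] at hx
        by_cases hx0 : x = 0
        · rw [hx0, mulVec_zero]
        · have hx' : A *ᵥ x = (μ : ℂ) • x := by
            rwa [Module.End.mem_eigenspace_iff, Matrix.toLin'_apply] at hx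
          rw [hP, hcf_cfc_mulVec_of_eigenvector hA χ hx' hx0]
          simp only [hχ, if_pos hμ, Complex.ofReal_one, one_smul]
      · rw [iSup_neg hμ, Submodule.mem_bot] at hx
        rw [hx, mulVec_zero]
    · intro x y hx hy
      rw [mulVec_add, hx, hy]
  -- `b P² - P A P ⪰ 0`
  have hpsd : (((b : ℝ) : ℂ) • (P * P) - P * A * P).PosSemidef := by
    have h := hcf_cfc_posSemidef hA (f := fun x => b * (χ x * χ x) - χ x * x * χ x) fun i => by
      simp only [hχ]
      split_ifs with hle
      · nlinarith
      · simp
    have hPAP : P * A * P = hA.cfc (fun x => χ x * x * χ x) := by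
      calc P * A * P = hA.cfc χ * hA.cfc (fun x => x) * hA.cfc χ := by rw [hcf_cfc_id]
        _ = hA.cfc (fun x => χ x * x * χ x) := by rw [hcf_cfc_mul, hcf_cfc_mul]
    have hPP : P * P = hA.cfc (fun x => χ x * χ x) := by rw [hP, hcf_cfc_mul]
    have heq : ((b : ℝ) : ℂ) • (P * P) - P * A * P =
        hA.cfc (fun x => b * (χ x * χ x) - χ x * x * χ x) := by
      rw [hPAP, hPP, hcf_cfc_smul, hcf_cfc_sub]
    rw [heq]
    exact h
  have h2 := hpsd.dotProduct_mulVec_nonneg v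
  rw [sub_mulVec, dotProduct_sub, smul_mulVec, dotProduct_smul, sub_nonneg, ← mulVec_mulVec,
    ← mulVec_mulVec, ← mulVec_mulVec, hPv] at h2
  -- `⟨v, P (A v)⟩ = ⟨P v, A v⟩ = ⟨v, A v⟩` and `⟨v, P (P v)⟩ = ⟨v, v⟩`
  have hPherm : Pᴴ = P := hcf_cfc_conjTranspose hA χ
  have hPA : star v ⬝ᵥ (P *ᵥ (A *ᵥ v)) = star v ⬝ᵥ (A *ᵥ v) := by
    have h := hcf_star_mulVec_dotProduct P v (A *ᵥ v)
    rw [hPherm, hPv] at h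
    exact h.symm
  rw [hPv, hPA] at h2
  have h3 := (Complex.le_def.1 h2).1
  rw [smul_eq_mul, Complex.re_ofReal_mul] at h3
  exact h3

/-- Eigenvalues of a Hermitian matrix are bounded by its operator norm. [folklore] -/
theorem hcf_eigenvalues_le_norm (i : n) : hA.eigenvalues i ≤ ‖A‖ := by
  have h := hA.eigenvalues_eq i
  have hu1 : (star (⇑(hA.eigenvectorBasis i) : n → ℂ) ⬝ᵥ (⇑(hA.eigenvectorBasis i) : n → ℂ)).re = 1 := by
    rw [Matrix.star_dotProduct_self_re]
    have : (WithLp.toLp 2 (⇑(hA.eigenvectorBasis i) : n → ℂ) : EuclideanSpace ℂ n) =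
        hA.eigenvectorBasis i := rfl
    rw [this, hA.eigenvectorBasis.norm_eq_one i, one_pow]
  have hray := Matrix.abs_re_star_dotProduct_mulVec_le A
    (⇑(hA.eigenvectorBasis i) : n → ℂ)
  rw [hu1, mul_one] at hray
  have h' : hA.eigenvalues i = (star (⇑(hA.eigenvectorBasis i) : n → ℂ) ⬝ᵥ
      A *ᵥ (⇑(hA.eigenvectorBasis i) : n → ℂ)).re := h
  rw [h']
  exact (le_abs_self _).trans hray

end SpectralCutoffs

end Summit.HubbardSuperconductivity.HubbardSuperconductivity.Theorems
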